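import Summits.QuantumFields.YangMills.Theorems.BalabanUVNodesN18RunningBetaLettersModel
import Summits.QuantumFields.YangMills.Theorems.BalabanUVNodesN18Beta0LimitOfKernelLetters

/-!
# BalabanUVNodes ∕ N18 — THE MIXED TWO-BOND MODEL, PART 2: W1-19b's finite-volume kernel letters from LETTERS ON THE AMPLITUDE LAW; the fading-amplitude
# instance — ONE scalar term family with RUNNING β meeting the kernel letters, N18 ∕ N22 and the guard at node U3's kernel objects (A6, MODEL LEVEL)
# (Track A, DAG node N18 = NE5; key K3⁷ `SpineGivenEndpointR13SepCoPH` = stmt-QuantumFields-20544, skeleton v5 941dddb108cbaacf; cell `pub-ymgap`, WIDTH SEAT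
# `pub-ymgap-dag-n18-w2` g7; `--supports stmt-QuantumFields-20544 --as helper`, COUNT-NEUTRAL; definition lane: two small `def`s, the rest theorems; 0 `sorry`)

WHY.  PART 1 (`…N18RunningBetaLettersModel`) typed the mixed two-bond family `crossTermFamily F a e` with an ARBITRARY amplitude law `a : HBeta`, computed def-B's windowed
kernels ∕ (1.21) limit ∕ (1.22) β in closed form and proved the REALIZATION `betaMerged F (crossTermFamily F β diag01) … = β`.  THIS FILE adds the KERNEL side:
* §4 W1-19b's finite-volume letters at the two-bond family FROM LETTERS ON THE AMPLITUDE LAW, with the letters' exact quantifier order: `GeometricIncrements` (every law,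
  every ratio) ∕ `PolLimitsExist` (every law); `WindowedDecay` at every rate `κ` from ONE bound per window sequence uniform in the level; `WindowedNE9` from
  history-Lipschitz moduli `Λ` of `a` (moduli `wt κ e · Λ`); `WindowedStepRate` at every run offset from a TWO-RUN LAW `|a (k+1) w − a k (tail w)| ≤ C₅θθ^k` on the
  boxes; hence (p606911, dag-n22-w3) node N18's `KernelStepRate`, `NE9 (EA …)`, `KernelDecay`.  So: a β-law that is bounded, history-Lipschitz and two-run-contracting
  on the boxes is SIMULTANEOUSLY def-B's β of a family meeting every kernel letter — β-side and kernel-side letters are jointly satisfiable whenever the β-law alone is.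
* §5 the FADING LAW `fadingLaw ω = (k, v) ↦ Σ_{i ≤ k} ω^{k+1−i} v_i` (dag-n18-w2 g6's amplitude, now AS THE β): it RUNS (`not_boxwiseConstant_fadingLaw`), its def-B
  one-loop numbers are computed (`beta0OfMerged_fadingLaw`: the reference amplitude with the last coupling switched off; `Beta0LimitExists` at EVERY reference history;
  the remainder at the face is EXACTLY `ω·g`), it is bounded ∕ Lipschitz (moduli `ω^{n−i}`) ∕ two-run-contracting (rate `ω`, g6's `fadingAmp_succ`); with the letter
  block `crossLetters γ ω κ e = ⟨κ, ω, |γ|ω·wt, wt, ω, 0, ω⟩` the fading two-bond model meets every §4 letter, `N18At` ∕ `N22At` at `u3OfRecord₁₃ θ (objects …) k` for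
  EVERY `θ : Stage13Params`, and ★ passes n18-w2 g0's guard THROUGH p592505's `sensitiveOnBoxes_objects_of_not_boxwiseConstant` with the antecedent inhabited;
  `Beta0LimitExists` is re-derived from the kernel letters alone by dag-n18-w1 g3's road (consistency); ★★★ `exists_termFamily_letters_and_runningBeta` packages the
  joint inhabitant: ONE family with W1-19b's letters ∧ `KernelStepRate` ∧ `NE9` ∧ `KernelDecay` ∧ `¬ BoxwiseConstant` ∧ g2's `RemainderNonvanishingOnBoxes` (every
  reference sequence) ∧ `Beta0LimitExists` (every reference history) — the positive twin of g6's model (letters ∧ β ≡ 0).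

HONEST FRAMING.  MODEL LEVEL (scalar algebra `𝔄 = V = ℝ`, chart `ρ = id`, one-colour basis; a test object): NOT Bałaban's merged term (1.6); inhabits NO letter OF RECORD
(`…OfRecord₁₃` read `θ`'s own term data), NOT `Provisos₁₃CoPH` (K0⁷ OPEN); `¬ BoxwiseConstant θ.γ β₁₃` AT THE RECORD neither proved nor refuted; nothing of Bałaban's
asserted; NE5 NOT PRINTED for d = 4; N18 ∕ N22 ∕ (D4) NOT discharged; K3⁷ OPEN, not claimed; counts UNMOVED (typed 28∕28 · discharged 5∕27, A 5∕28 — the chair's single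
count line is the only count); one finite 𝕋⁴ programme at fixed ε — R4 closes the CONDITIONAL rung `BalabanLadder.UV` only: NOT ℝ⁴ ∕ infinite volume ∕ OS ∕ mass gap;
the YM mass gap (Clay) is NOT proved by any of this.  Nothing landed edited.

Sources (types only): [Balaban1987RG1] CMP **109** (1987) Thm 1 p. 259, (1.18) p. 263, (1.20)–(1.22) p. 264, (2.12)–(2.14) p. 268, (5.10) p. 293; [Balaban1988RG2Cluster]
CMP **116** (2.13)–(2.14).
-/

noncomputable section

open Filter Topology
open scoped BigOperators

namespace YMDAG.N18.RunningBetaLettersModel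

open Literature.MathematicalPhysics.QuantumFieldTheory.Balaban1983to89
open Literature.MathematicalPhysics.QuantumFieldTheory.Balaban1983to89.T4Continuum (T4Family)
open Literature.MathematicalPhysics.QuantumFieldTheory.Balaban1983to89.T4OutputRate (Window NE9)
open Literature.MathematicalPhysics.QuantumFieldTheory.Balaban1983to89.FlowStep (Box HBeta)
open Literature.MathematicalPhysics.QuantumFieldTheory.Balaban1983to89.T4FlagMemory (extd)
open Literature.MathematicalPhysics.QuantumFieldTheory.Balaban1983to89.B12PolarizationTensor120 (polTensor polComp expChart)
open Literature.MathematicalPhysics.QuantumFieldTheory.Balaban1983to89.Node00 (TermFamily1 siteOfInt polScalar polWindow polLimit PolLimitExists Stage13Params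
  U3Letters₁₁ betaMerged betaOfMerged beta0OfMerged Beta0LimitExists)
open Literature.MathematicalPhysics.QuantumFieldTheory.Balaban1983to89.Node00.U3OfKernels (histPrefix kernelA EA objects KernelDecay)
open Literature.MathematicalPhysics.QuantumFieldTheory.Balaban1983to89.Node00.U3KernelLetters (PolLimitsExist GeometricIncrements WindowedDecay WindowedNE9
  WindowedStepRate KernelStepRate)
open Literature.MathematicalPhysics.QuantumFieldTheory.Balaban1983to89.B12Sec2to5 (l1)
open YMDAG.UVSplit (N18At N22At u3OfRecord₁₃)
open YMDAG.N18.U3Guards (SensitiveOnBoxes BoxwiseConstant)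
open YMDAG.N18.BetaBoxDegeneracy (RemainderNonvanishingOnBoxes)
open Literature.MathematicalPhysics.QuantumFieldTheory.Balaban1983to89.B12Beta (HistBox)
open YMDAG.N18.FiniteVolumeLettersModel (bondEval bondEval_apply siteOfInt_eventually_ne fadingAmp fadingAmp_succ fadingAmp_zero abs_fadingAmp_sub_le
  abs_fadingAmp_le histPrefix_mem_box)

/-! ## §4 W1-19b's finite-volume kernel letters at the two-bond family, from LETTERS ON THE AMPLITUDE LAW -/

section Letters

variable (F : T4Family)

/-- **THE INCREMENTS LETTER, EVERY AMPLITUDE LAW AND EVERY RATIO `r`** (the windowed kernels are eventually CONSTANT in `K`). [cite: Balaban1987RG1, (1.21) p.264; model] -/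
theorem geometricIncrements_cross (a : HBeta) (e : Fin 4 → ℤ) (γ r : ℝ) :
    GeometricIncrements F (crossTermFamily F a e) (ContinuousLinearMap.id ℝ ℝ) (Module.Basis.singleton Unit ℝ) (Window γ) r := by
  intro g _ k μ ν z
  obtain ⟨K₀, hK₀⟩ := eventually_atTop.1 (polWindow_crossTermFamily_eventually F a e k (histPrefix g k) μ ν z)
  refine ⟨K₀, 0, fun K hK => ?_⟩
  rw [hK₀ (K + 1) (le_trans hK (Nat.le_succ K)), hK₀ K hK, sub_self, abs_zero, zero_mul]

/-- The (1.21)-existence letter on the window, every amplitude law. [cite: Balaban1987RG1, (1.21) p.264; model] -/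
theorem polLimitsExist_cross (a : HBeta) (e : Fin 4 → ℤ) (γ : ℝ) :
    PolLimitsExist F (crossTermFamily F a e) (ContinuousLinearMap.id ℝ ℝ) (Module.Basis.singleton Unit ℝ) (Window γ) :=
  fun g _ k => polLimitExists_crossTermFamily F a e k (histPrefix g k)

/-- ★ **THE WINDOWED (5.10) LETTER AT EVERY RATE `κ` FROM AN AMPLITUDE BOUND ALONG THE WINDOW** (one constant per coupling sequence, uniform in the level — exactly the
letter's quantifier order): `|a k (g_0,…,g_k)| ≤ C_g` gives `WindowedDecay … μ ν κ` with `C₀ = C_g · wt κ e`. [cite: Balaban1987RG1, (5.10) p.293; model] -/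
theorem windowedDecay_cross {a : HBeta} {γ : ℝ} (ha : ∀ g ∈ Window γ, ∃ C : ℝ, ∀ k, |a k (histPrefix g k)| ≤ C) (e : Fin 4 → ℤ) (μ ν : Fin 4) (κ : ℝ) :
    WindowedDecay F (crossTermFamily F a e) (ContinuousLinearMap.id ℝ ℝ) (Module.Basis.singleton Unit ℝ) (Window γ) μ ν κ := by
  intro g hg
  obtain ⟨C, hC⟩ := ha g hg
  refine ⟨C * wt κ e, fun k z => ?_⟩
  filter_upwards [polWindow_crossTermFamily_eventually F a e k (histPrefix g k) μ ν z] with K hK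
  rw [hK, neg_mul]
  exact (abs_crossKernel_le _ e μ ν z κ).trans
    (mul_le_mul_of_nonneg_right (mul_le_mul_of_nonneg_right (hC k) (wt_nonneg κ e)) (Real.exp_nonneg _))

/-- ★ **THE WINDOWED NE9 LETTER FROM A HISTORY-LIPSCHITZ AMPLITUDE LAW**: moduli `Λ` for `a` along the window give `WindowedNE9 … κ (wt κ e · Λ)`.
[cite: Balaban1987RG1, (1.18) p.263; model] -/
theorem windowedNE9_cross {a : HBeta} {γ : ℝ} {Λ : ℕ → ℕ → ℝ}
    (ha : ∀ g ∈ Window γ, ∀ g' ∈ Window γ, ∀ k, |a k (histPrefix g k) - a k (histPrefix g' k)| ≤ ∑ i ∈ Finset.range (k + 1), Λ (k + 1) i * |g i - g' i|)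
    (e : Fin 4 → ℤ) (κ : ℝ) :
    WindowedNE9 F (crossTermFamily F a e) (ContinuousLinearMap.id ℝ ℝ) (Module.Basis.singleton Unit ℝ) (Window γ) κ (fun n i => wt κ e * Λ n i) := by
  intro g hg g' hg' k μ ν z
  filter_upwards [polWindow_crossTermFamily_eventually F a e k (histPrefix g k) μ ν z,
    polWindow_crossTermFamily_eventually F a e k (histPrefix g' k) μ ν z] with K hK hK'
  rw [hK, hK', crossKernel_sub]
  refine (abs_crossKernel_le _ e μ ν z κ).trans ?_
  have hw := wt_nonneg κ e
  calc |a k (histPrefix g k) - a k (histPrefix g' k)| * wt κ e * Real.exp (-(κ * l1 z))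
        ≤ (∑ i ∈ Finset.range (k + 1), Λ (k + 1) i * |g i - g' i|) * wt κ e * Real.exp (-(κ * l1 z)) :=
        mul_le_mul_of_nonneg_right (mul_le_mul_of_nonneg_right (ha g hg g' hg' k) hw) (Real.exp_nonneg _)
    _ = Real.exp (-(κ * l1 z)) * ∑ i ∈ Finset.range (k + 1), wt κ e * Λ (k + 1) i * |g i - g' i| := by
        rw [Finset.sum_mul, Finset.sum_mul, Finset.mul_sum]
        exact Finset.sum_congr rfl fun i _ => by ring

/-- ★ **THE WINDOWED TWO-RUN STEP RATE FROM A TWO-RUN AMPLITUDE LAW, EVERY RUN OFFSET `s` AND RATE `κ`**: `|a (k+1) w − a k (tail w)| ≤ C₅·θ·θ^k` on the boxes gives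
`WindowedStepRate … γ s κ θ ((C₅·wt κ e)·θ)` (the letter's `C'·θ^k` with `C' = C₅'·θ₅`). [cite: Balaban1987RG1, Thm 1 p.259; model] -/
theorem windowedStepRate_cross {a : HBeta} {γ θ C₅ : ℝ} (ha : ∀ (k : ℕ) (w : Fin (k + 2) → ℝ), w ∈ Box γ (k + 1) → |a (k + 1) w - a k (Fin.tail w)| ≤ C₅ * θ * θ ^ k)
    (e : Fin 4 → ℤ) (s : ℕ) (κ : ℝ) :
    WindowedStepRate F (crossTermFamily F a e) (ContinuousLinearMap.id ℝ ℝ) (Module.Basis.singleton Unit ℝ) γ s κ θ ((C₅ * wt κ e) * θ) := by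
  intro k w hw μ ν x
  obtain ⟨K₁, hK₁⟩ := eventually_atTop.1 (polWindow_crossTermFamily_eventually F a e (k + 1) w μ ν x)
  obtain ⟨K₂, hK₂⟩ := eventually_atTop.1 (polWindow_crossTermFamily_eventually F a e k (Fin.tail w) μ ν x)
  refine eventually_atTop.2 ⟨max K₁ K₂, fun K hK => ?_⟩
  rw [hK₁ (K + s) ((le_of_max_le_left hK).trans (Nat.le_add_right K s)), hK₂ K (le_of_max_le_right hK), crossKernel_sub, neg_mul]
  refine (abs_crossKernel_le _ e μ ν x κ).trans ?_
  have h := mul_le_mul_of_nonneg_right (mul_le_mul_of_nonneg_right (ha k w hw) (wt_nonneg κ e)) (Real.exp_nonneg (-(κ * l1 x)))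
  calc _ ≤ C₅ * θ * θ ^ k * wt κ e * Real.exp (-(κ * l1 x)) := h
    _ = C₅ * wt κ e * θ * θ ^ k * Real.exp (-(κ * l1 x)) := by ring

/-- ★ **NODE N18's LETTER AT THE TWO-BOND FAMILY** from the two-run amplitude law (p606911 `kernelStepRate_of_geometricIncrements_of_windowed`, ratio `0`).
[cite: Balaban1987RG1, Thm 1 p.259; model] -/
theorem kernelStepRate_cross {a : HBeta} {γ θ C₅ : ℝ} (ha : ∀ (k : ℕ) (w : Fin (k + 2) → ℝ), w ∈ Box γ (k + 1) → |a (k + 1) w - a k (Fin.tail w)| ≤ C₅ * θ * θ ^ k)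
    (e : Fin 4 → ℤ) (κ : ℝ) :
    KernelStepRate F (crossTermFamily F a e) (ContinuousLinearMap.id ℝ ℝ) (Module.Basis.singleton Unit ℝ) γ κ θ (C₅ * wt κ e) :=
  YMDAG.N18.PolLimitRate.kernelStepRate_of_geometricIncrements_of_windowed F _ _ 0 zero_lt_one (geometricIncrements_cross F a e γ 0)
    (windowedStepRate_cross F ha e 0 κ)

/-- NE9 of the two-bond family's kernel functional (dag-n22-w3 `ne9_EA_of_windowed`). [cite: Balaban1987RG1, (1.18) p.263; model] -/
theorem ne9_EA_cross {a : HBeta} {γ : ℝ} {Λ : ℕ → ℕ → ℝ}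
    (ha : ∀ g ∈ Window γ, ∀ g' ∈ Window γ, ∀ k, |a k (histPrefix g k) - a k (histPrefix g' k)| ≤ ∑ i ∈ Finset.range (k + 1), Λ (k + 1) i * |g i - g' i|)
    (e : Fin 4 → ℤ) (κ : ℝ) :
    NE9 (EA F (crossTermFamily F a e) (ContinuousLinearMap.id ℝ ℝ) (Module.Basis.singleton Unit ℝ)) (Window γ) κ (fun n i => wt κ e * Λ n i) :=
  YMDAG.N22.AtKernels.ne9_EA_of_windowed F _ _ _ (polLimitsExist_cross F a e γ) (windowedNE9_cross F ha e κ)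

/-- The (5.10)-class binder of the limiting kernels of the two-bond family (dag-n22-w3 `kernelDecay_of_windowed`). [cite: Balaban1987RG1, (5.10) p.293; model] -/
theorem kernelDecay_cross {a : HBeta} {γ : ℝ} (ha : ∀ g ∈ Window γ, ∃ C : ℝ, ∀ k, |a k (histPrefix g k)| ≤ C) (e : Fin 4 → ℤ) (μ ν : Fin 4) (κ : ℝ) :
    KernelDecay F (crossTermFamily F a e) (ContinuousLinearMap.id ℝ ℝ) (Module.Basis.singleton Unit ℝ) (Window γ) μ ν κ :=
  YMDAG.N22.AtKernels.kernelDecay_of_windowed F _ _ _ (polLimitsExist_cross F a e γ) (windowedDecay_cross F ha e μ ν κ)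

/-- ★★ **JOINT SATISFIABILITY TRANSFER**: a β-law `a` that is BOUNDED along every window sequence (uniformly in the level), HISTORY-LIPSCHITZ with moduli `Λ` and
TWO-RUN-CONTRACTING on the boxes IS def-B's (1.22) β of ONE scalar term family that meets, at every rate `κ`, W1-19b's finite-volume kernel letters, node N18's
`KernelStepRate`, `NE9` and the (5.10) class — β-side letters about `a` and the kernel-side letters are then JOINTLY inhabited (model level).
[cite: Balaban1987RG1, (1.18) p.263, (1.20)–(1.22) p.264, (5.10) p.293, Thm 1 p.259; model] -/
theorem exists_termFamily_kernelLetters_and_betaMerged_eq {a : HBeta} {γ θ C₅ : ℝ} {Λ : ℕ → ℕ → ℝ}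
    (hb : ∀ g ∈ Window γ, ∃ C : ℝ, ∀ k, |a k (histPrefix g k)| ≤ C)
    (hl : ∀ g ∈ Window γ, ∀ g' ∈ Window γ, ∀ k, |a k (histPrefix g k) - a k (histPrefix g' k)| ≤ ∑ i ∈ Finset.range (k + 1), Λ (k + 1) i * |g i - g' i|)
    (ht : ∀ (k : ℕ) (w : Fin (k + 2) → ℝ), w ∈ Box γ (k + 1) → |a (k + 1) w - a k (Fin.tail w)| ≤ C₅ * θ * θ ^ k) (κ : ℝ) :
    ∃ ℰ : TermFamily1 F ℝ,
      betaMerged F ℰ (ContinuousLinearMap.id ℝ ℝ) (Module.Basis.singleton Unit ℝ) = a ∧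
      GeometricIncrements F ℰ (ContinuousLinearMap.id ℝ ℝ) (Module.Basis.singleton Unit ℝ) (Window γ) 0 ∧
      PolLimitsExist F ℰ (ContinuousLinearMap.id ℝ ℝ) (Module.Basis.singleton Unit ℝ) (Window γ) ∧
      (∀ μ ν, WindowedDecay F ℰ (ContinuousLinearMap.id ℝ ℝ) (Module.Basis.singleton Unit ℝ) (Window γ) μ ν κ) ∧
      WindowedNE9 F ℰ (ContinuousLinearMap.id ℝ ℝ) (Module.Basis.singleton Unit ℝ) (Window γ) κ (fun n i => wt κ diag01 * Λ n i) ∧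
      (∀ s, WindowedStepRate F ℰ (ContinuousLinearMap.id ℝ ℝ) (Module.Basis.singleton Unit ℝ) γ s κ θ ((C₅ * wt κ diag01) * θ)) ∧
      KernelStepRate F ℰ (ContinuousLinearMap.id ℝ ℝ) (Module.Basis.singleton Unit ℝ) γ κ θ (C₅ * wt κ diag01) ∧
      NE9 (EA F ℰ (ContinuousLinearMap.id ℝ ℝ) (Module.Basis.singleton Unit ℝ)) (Window γ) κ (fun n i => wt κ diag01 * Λ n i) ∧
      (∀ μ ν, KernelDecay F ℰ (ContinuousLinearMap.id ℝ ℝ) (Module.Basis.singleton Unit ℝ) (Window γ) μ ν κ) :=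
  ⟨crossTermFamily F a diag01, betaMerged_crossTermFamily_diag01 F a, geometricIncrements_cross F a _ γ 0, polLimitsExist_cross F a _ γ,
    fun μ ν => windowedDecay_cross F hb _ μ ν κ, windowedNE9_cross F hl _ κ, fun s => windowedStepRate_cross F ht _ s κ, kernelStepRate_cross F ht _ κ,
    ne9_EA_cross F hl _ κ, fun μ ν => kernelDecay_cross F hb _ μ ν κ⟩

end Letters

/-! ## §5 THE FADING-AMPLITUDE INSTANCE: all letters + running β + N18 ∕ N22 ∕ the guard at node U3's kernel objects -/

section Fading

variable (F : T4Family)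

/-- **THE FADING AMPLITUDE LAW** `(k, v) ↦ Σ_{i ≤ k} ω^{k+1−i} v_i` of dag-n18-w2 g6's on-site model, as an `HBeta`. [folklore] -/
def fadingLaw (ω : ℝ) : HBeta := fun k v => fadingAmp ω k v

/-- Face (`rfl`). [folklore] -/
@[simp] theorem fadingLaw_apply (ω : ℝ) (k : ℕ) (v : Fin (k + 1) → ℝ) : fadingLaw ω k v = fadingAmp ω k v := rfl

/-- ★ **THE FADING LAW RUNS WITH THE COUPLINGS**: it is NOT boxwise constant on any window `γ > 0` (`ω ≠ 0`): at level `0` the box histories `(γ)`, `(γ∕2)` give `ωγ ≠ ωγ∕2`. [folklore] -/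
theorem not_boxwiseConstant_fadingLaw {ω γ : ℝ} (hω : ω ≠ 0) (hγ : 0 < γ) : ¬ BoxwiseConstant γ (fadingLaw ω) := by
  intro h
  have h0 := h 0 (fun _ => γ) (fun _ => γ / 2) (fun _ _ => ⟨hγ, le_rfl⟩) (fun _ _ => ⟨half_pos hγ, half_le_self hγ.le⟩)
  simp only [fadingLaw_apply, fadingAmp_zero] at h0
  have : ω * γ = ω * (γ / 2) := h0
  have h1 : ω * (γ / 2) = 0 := by linarith
  rcases mul_eq_zero.1 h1 with h2 | h2
  · exact hω h2
  · linarith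

/-- Updating the LAST coupling shifts the fading amplitude by `ω·(g − v_k)` (its weight is `ω`). [folklore] -/
theorem fadingAmp_update_last (ω : ℝ) (k : ℕ) (v : Fin (k + 1) → ℝ) (g : ℝ) :
    fadingAmp ω k (Function.update v (Fin.last k) g) = fadingAmp ω k v + ω * (g - v (Fin.last k)) := by
  unfold fadingAmp
  rw [Fin.sum_univ_castSucc, Fin.sum_univ_castSucc]
  have h1 : ∀ i : Fin k, Function.update v (Fin.last k) g (Fin.castSucc i) = v (Fin.castSucc i) := fun i =>
    Function.update_of_ne (Fin.castSucc_lt_last i).ne _ _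
  simp only [h1, Function.update_self, Fin.val_last, Fin.val_castSucc]
  have h2 : k + 1 - k = 1 := by omega
  rw [h2, pow_one]
  ring

/-- ★ **def-B's `Beta0LimitExists` FOR THE FADING LAW, EVERY REFERENCE HISTORY** (affine, hence continuous, in the last coupling). [cite: Balaban1987RG1, (2.12)–(2.14) p.268; model] -/
theorem tendsto_fadingLaw_update_last (ω : ℝ) (k : ℕ) (v₀ : Fin (k + 1) → ℝ) :
    Tendsto (fun g : ℝ => fadingLaw ω k (Function.update v₀ (Fin.last k) g)) (nhdsWithin (0 : ℝ) (Set.Ioi 0))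
      (𝓝 (fadingAmp ω k v₀ - ω * v₀ (Fin.last k))) := by
  simp only [fadingLaw_apply, fadingAmp_update_last]
  refine tendsto_nhdsWithin_of_tendsto_nhds ?_
  have hc : Continuous fun g : ℝ => fadingAmp ω k v₀ + ω * (g - v₀ (Fin.last k)) := by fun_prop
  have := hc.tendsto 0
  rwa [zero_sub, mul_neg, ← sub_eq_add_neg] at this

/-- def-B's named clause for the fading law. [cite: Balaban1987RG1, (2.12)–(2.14) p.268; model] -/
theorem beta0LimitExists_fadingLaw (ω : ℝ) (v₀ : (k : ℕ) → (Fin (k + 1) → ℝ)) : Beta0LimitExists (fadingLaw ω) v₀ := fun k =>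
  ⟨_, tendsto_fadingLaw_update_last ω k (v₀ k)⟩

/-- **THE ONE-LOOP NUMBERS OF THE FADING LAW IN CLOSED FORM**: `β⁰_k = fadingAmp ω k (v₀ k) − ω·(v₀ k)_k` (the amplitude of the reference history with its last coupling
switched off). [cite: Balaban1987RG1, (2.12)–(2.14) p.268; model] -/
theorem beta0OfMerged_fadingLaw (ω : ℝ) (v₀ : (k : ℕ) → (Fin (k + 1) → ℝ)) (k : ℕ) :
    beta0OfMerged (fadingLaw ω) v₀ k = fadingAmp ω k (v₀ k) - ω * v₀ k (Fin.last k) :=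
  (tendsto_fadingLaw_update_last ω k (v₀ k)).limUnder_eq

/-- ★ **THE REMAINDER AT THE FACE IS `ω·g` — NON-ZERO AT EVERY POSITIVE LAST COUPLING**: `β(v₀ with last g) − β⁰ = ω·g`. [cite: Balaban1987RG1, (2.13) p.268; model] -/
theorem fadingLaw_update_last_sub_beta0OfMerged (ω : ℝ) (v₀ : (k : ℕ) → (Fin (k + 1) → ℝ)) (k : ℕ) (g : ℝ) :
    fadingLaw ω k (Function.update (v₀ k) (Fin.last k) g) - beta0OfMerged (fadingLaw ω) v₀ k = ω * g := by
  rw [beta0OfMerged_fadingLaw, fadingLaw_apply, fadingAmp_update_last]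
  ring

/-- The fading law is BOUNDED ALONG EVERY WINDOW SEQUENCE uniformly in the level (`|a k (g_0..g_k)| ≤ |γ|·ω∕(1−ω)`; g6 `abs_fadingAmp_le`). [folklore] -/
theorem fadingLaw_bounded {ω : ℝ} (hω : 0 ≤ ω) (hω1 : ω < 1) (γ : ℝ) :
    ∀ g ∈ Window γ, ∃ C : ℝ, ∀ k, |fadingLaw ω k (histPrefix g k)| ≤ C := fun _ hg =>
  ⟨|γ| * (ω / (1 - ω)), fun k => abs_fadingAmp_le hω hω1 (histPrefix_mem_box hg k)⟩

/-- The fading law is HISTORY-LIPSCHITZ with moduli `ω^{n−i}` (g6 `abs_fadingAmp_sub_le`). [folklore] -/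
theorem fadingLaw_lipschitz {ω : ℝ} (hω : 0 ≤ ω) (γ : ℝ) :
    ∀ g ∈ Window γ, ∀ g' ∈ Window γ, ∀ k, |fadingLaw ω k (histPrefix g k) - fadingLaw ω k (histPrefix g' k)| ≤
      ∑ i ∈ Finset.range (k + 1), (fun n i => ω ^ (n - i)) (k + 1) i * |g i - g' i| := by
  intro g _ g' _ k
  refine (abs_fadingAmp_sub_le hω k _ _).trans (le_of_eq ?_)
  simp only [Node00.U3OfKernels.histPrefix_apply]
  exact Fin.sum_univ_eq_sum_range (fun i => ω ^ (k + 1 - i) * |g i - g' i|) (k + 1)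

/-- The fading law's TWO-RUN RATE: `|a (k+1) w − a k (tail w)| = ω^{k+2} w_0 ≤ (|γ|ω)·ω·ω^k` on the boxes (g6 `fadingAmp_succ`). [folklore] -/
theorem fadingLaw_twoRun {ω : ℝ} (hω : 0 ≤ ω) (γ : ℝ) :
    ∀ (k : ℕ) (w : Fin (k + 2) → ℝ), w ∈ Box γ (k + 1) → |fadingLaw ω (k + 1) w - fadingLaw ω k (Fin.tail w)| ≤ |γ| * ω * ω * ω ^ k := by
  intro k w hw
  have hw0 := hw 0 (Set.mem_univ _)
  rw [fadingLaw_apply, fadingLaw_apply, fadingAmp_succ, add_sub_cancel_right, abs_mul, abs_of_nonneg (pow_nonneg hω _), abs_of_pos hw0.1]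
  calc ω ^ (k + 2) * w 0 ≤ ω ^ (k + 2) * |γ| := mul_le_mul_of_nonneg_left (hw0.2.trans (le_abs_self γ)) (pow_nonneg hω _)
    _ = |γ| * ω * ω * ω ^ k := by ring

/-- **THE LETTER BLOCK OF THE TWO-BOND FADING MODEL** `⟨κ, θ₅, C₅, C₉, ω, cr, ρ⟩ := ⟨κ, ω, |γ|ω·wt, wt, ω, 0, ω⟩` with `wt = wt κ e`.
[cite: Balaban1987RG1, (1.20)–(1.22) p.264 (hypothesis dictionary); model] -/
def crossLetters (γ ω κ : ℝ) (e : Fin 4 → ℤ) : U3Letters₁₁ := ⟨κ, ω, |γ| * ω * wt κ e, wt κ e, ω, 0, ω⟩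

/-- The block passes the displayed letter signs for `0 ≤ κ`, `0 < ω < 1`. [folklore] -/
theorem crossLetters_signs (γ : ℝ) {ω κ : ℝ} (hκ : 0 ≤ κ) (hω : 0 < ω) (hω1 : ω < 1) (e : Fin 4 → ℤ) : (crossLetters γ ω κ e).Signs :=
  ⟨hκ, hω, hω1, mul_nonneg (mul_nonneg (abs_nonneg γ) hω.le) (wt_nonneg κ e), wt_nonneg κ e, hω.le, hω1, le_rfl, le_rfl, le_rfl, hω1⟩

/-- The block's history moduli are `wt·ω^{n−i}`. [folklore] -/
theorem crossLetters_moduli (γ ω κ : ℝ) (e : Fin 4 → ℤ) : (crossLetters γ ω κ e).moduli = fun n i => wt κ e * ω ^ (n - i) := by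
  funext n i; simp [crossLetters, U3Letters₁₁.moduli]

/-- W1-19b's windowed (5.10) letter at the fading two-bond model, every `κ`, `μ`, `ν`. [cite: Balaban1987RG1, (5.10) p.293; model] -/
theorem windowedDecay_fadingCross {ω : ℝ} (hω : 0 ≤ ω) (hω1 : ω < 1) (γ : ℝ) (e : Fin 4 → ℤ) (μ ν : Fin 4) (κ : ℝ) :
    WindowedDecay F (crossTermFamily F (fadingLaw ω) e) (ContinuousLinearMap.id ℝ ℝ) (Module.Basis.singleton Unit ℝ) (Window γ) μ ν κ :=
  windowedDecay_cross F (fadingLaw_bounded hω hω1 γ) e μ ν κ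

/-- W1-19b's windowed NE9 letter at the fading two-bond model with the block's moduli. [cite: Balaban1987RG1, (1.18) p.263; model] -/
theorem windowedNE9_fadingCross {ω : ℝ} (hω : 0 ≤ ω) (γ : ℝ) (e : Fin 4 → ℤ) (κ : ℝ) :
    WindowedNE9 F (crossTermFamily F (fadingLaw ω) e) (ContinuousLinearMap.id ℝ ℝ) (Module.Basis.singleton Unit ℝ) (Window γ) κ (crossLetters γ ω κ e).moduli := by
  rw [crossLetters_moduli]
  exact windowedNE9_cross F (fadingLaw_lipschitz hω γ) e κ

/-- W1-19b's windowed two-run step rate at the fading two-bond model, every run offset `s`. [cite: Balaban1987RG1, Thm 1 p.259; model] -/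
theorem windowedStepRate_fadingCross {ω : ℝ} (hω : 0 ≤ ω) (γ : ℝ) (e : Fin 4 → ℤ) (s : ℕ) (κ : ℝ) :
    WindowedStepRate F (crossTermFamily F (fadingLaw ω) e) (ContinuousLinearMap.id ℝ ℝ) (Module.Basis.singleton Unit ℝ) γ s κ ω ((|γ| * ω * wt κ e) * ω) :=
  windowedStepRate_cross F (fadingLaw_twoRun hω γ) e s κ

/-- ★ **NODE N18's LETTER AT THE FADING TWO-BOND MODEL** `KernelStepRate … γ κ ω (|γ|ω·wt)`. [cite: Balaban1987RG1, Thm 1 p.259; model] -/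
theorem kernelStepRate_fadingCross {ω : ℝ} (hω : 0 ≤ ω) (γ : ℝ) (e : Fin 4 → ℤ) (κ : ℝ) :
    KernelStepRate F (crossTermFamily F (fadingLaw ω) e) (ContinuousLinearMap.id ℝ ℝ) (Module.Basis.singleton Unit ℝ) γ κ ω (|γ| * ω * wt κ e) :=
  kernelStepRate_cross F (fadingLaw_twoRun hω γ) e κ

/-- NE9 of the fading two-bond model's kernel functional with the block's moduli. [cite: Balaban1987RG1, (1.18) p.263; model] -/
theorem ne9_EA_fadingCross {ω : ℝ} (hω : 0 ≤ ω) (γ : ℝ) (e : Fin 4 → ℤ) (κ : ℝ) :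
    NE9 (EA F (crossTermFamily F (fadingLaw ω) e) (ContinuousLinearMap.id ℝ ℝ) (Module.Basis.singleton Unit ℝ)) (Window γ) κ (crossLetters γ ω κ e).moduli := by
  rw [crossLetters_moduli]
  exact ne9_EA_cross F (fadingLaw_lipschitz hω γ) e κ

/-- The (5.10)-class binder at the fading two-bond model. [cite: Balaban1987RG1, (5.10) p.293; model] -/
theorem kernelDecay_fadingCross {ω : ℝ} (hω : 0 ≤ ω) (hω1 : ω < 1) (γ : ℝ) (e : Fin 4 → ℤ) (μ ν : Fin 4) (κ : ℝ) :
    KernelDecay F (crossTermFamily F (fadingLaw ω) e) (ContinuousLinearMap.id ℝ ℝ) (Module.Basis.singleton Unit ℝ) (Window γ) μ ν κ :=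
  kernelDecay_cross F (fadingLaw_bounded hω hω1 γ) e μ ν κ

variable {N : ℕ} [NeZero N]

/-- **N18 AT THE FADING TWO-BOND MODEL's KERNEL OBJECTS**, every Stage-13 tuple and run length (dag-n18-w1's `…_iff_kernelStepRate_letter`). MODEL LEVEL.
[cite: Balaban1987RG1, Thm 1 p.259; model] -/
theorem n18At_fadingCross {ω κ : ℝ} (hω : 0 < ω) (e : Fin 4 → ℤ) (θ : Stage13Params F N) (k : ℕ) :
    N18At (u3OfRecord₁₃ θ (objects F (crossTermFamily F (fadingLaw ω) e) (ContinuousLinearMap.id ℝ ℝ) (Module.Basis.singleton Unit ℝ) (crossLetters θ.γ ω κ e)) k) :=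
  (YMDAG.N18.AtRecordOfKernelLetters.n18At_u3OfRecord₁₃_objects_iff_kernelStepRate_letter F _ _ _ θ (crossLetters θ.γ ω κ e) k).2
    (kernelStepRate_fadingCross F hω.le θ.γ e κ)

/-- **N22 AT THE FADING TWO-BOND MODEL's KERNEL OBJECTS**, every Stage-13 tuple and run length (dag-n22-w3's `…_objects_of_ne9`; `0 ≤ κ`, `0 < ω < 1`). MODEL LEVEL.
[cite: Balaban1987RG1, (1.18) p.263; model] -/
theorem n22At_fadingCross {ω κ : ℝ} (hκ : 0 ≤ κ) (hω : 0 < ω) (hω1 : ω < 1) (e : Fin 4 → ℤ) (θ : Stage13Params F N) (k : ℕ) :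
    N22At (u3OfRecord₁₃ θ (objects F (crossTermFamily F (fadingLaw ω) e) (ContinuousLinearMap.id ℝ ℝ) (Module.Basis.singleton Unit ℝ) (crossLetters θ.γ ω κ e)) k) :=
  YMDAG.N22.AtKernels.n22At_u3OfRecord₁₃_objects_of_ne9 F _ _ _ θ (crossLetters θ.γ ω κ e) (crossLetters_signs θ.γ hκ hω hω1 e) k
    (ne9_EA_fadingCross F hω.le θ.γ e κ)

/-- ★★ **AT THE DIAGONAL SEPARATION THE FADING TWO-BOND MODEL HAS RUNNING β AND PASSES THE GUARD NON-VACUOUSLY**: `betaMerged = fadingLaw ω` is not boxwise constant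
(`ω > 0`, window `γ > 0`), so p592505's `sensitiveOnBoxes_objects_of_not_boxwiseConstant` APPLIES (its antecedent inhabited) — in contrast with g6's on-site model, where
the guard held while β ≡ 0. [folklore] -/
theorem sensitiveOnBoxes_fadingCross {ω γ : ℝ} (hω : 0 < ω) (hγ : 0 < γ) (ℓ : U3Letters₁₁) (k : ℕ) :
    SensitiveOnBoxes ((objects F (crossTermFamily F (fadingLaw ω) diag01) (ContinuousLinearMap.id ℝ ℝ) (Module.Basis.singleton Unit ℝ) ℓ).EA k) γ :=
  sensitiveOnBoxes_objects_cross F (not_boxwiseConstant_fadingLaw hω.ne' hγ) ℓ (fun _ => 0) k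

/-- def-B's `Beta0LimitExists` for the fading two-bond model ALSO follows from its kernel letters alone (dag-n18-w1 g3's road `beta0LimitExists_betaMerged_of_ne9`:
NE9 + the (5.10) clause + admissible reference histories; `0 < κ`) — consistent with the closed form `beta0OfMerged_fadingLaw`. [cite: Balaban1987RG1, (2.12)–(2.14) p.268; model] -/
theorem beta0LimitExists_fadingCross_of_letters {ω κ γ : ℝ} (hκ : 0 < κ) (hω : 0 ≤ ω) (hω1 : ω < 1) (e : Fin 4 → ℤ)
    {v₀ : (k : ℕ) → (Fin (k + 1) → ℝ)} (hv₀ : ∀ k i, 0 < v₀ k i ∧ v₀ k i ≤ γ) :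
    Beta0LimitExists (betaMerged F (crossTermFamily F (fadingLaw ω) e) (ContinuousLinearMap.id ℝ ℝ) (Module.Basis.singleton Unit ℝ)) v₀ :=
  YMDAG.N18.Beta0LimitOfKernelLetters.beta0LimitExists_betaMerged_of_ne9 F _ _ _ hκ (ne9_EA_fadingCross F hω γ e κ) (kernelDecay_fadingCross F hω hω1 γ e 0 1 κ) hv₀

/-- ★★★ **THE JOINT INHABITANT** (A6, MODEL LEVEL): for every window `γ > 0`, rate `0 ≤ κ` and fading rate `0 < ω < 1` there is ONE scalar term family meeting W1-19b's
finite-volume kernel letters (`GeometricIncrements` at ratio `0`, `PolLimitsExist`, `WindowedDecay` at every `μ ν`, `WindowedNE9`, `WindowedStepRate` at every run offset),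
node N18's `KernelStepRate`, `NE9` and the (5.10) class of its limiting kernels, WHOSE def-B β RUNS WITH THE COUPLINGS (`¬ BoxwiseConstant`, g2's
`RemainderNonvanishingOnBoxes` against ANY reference numbers) and has def-B's one-sided limits `Beta0LimitExists` at EVERY reference history.
[cite: Balaban1987RG1, (1.18) p.263, (1.20)–(1.22) p.264, (5.10) p.293, Thm 1 p.259; model] -/
theorem exists_termFamily_letters_and_runningBeta {γ ω : ℝ} (hγ : 0 < γ) (κ : ℝ) (hω : 0 < ω) (hω1 : ω < 1) :
    ∃ ℰ : TermFamily1 F ℝ,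
      GeometricIncrements F ℰ (ContinuousLinearMap.id ℝ ℝ) (Module.Basis.singleton Unit ℝ) (Window γ) 0 ∧
      PolLimitsExist F ℰ (ContinuousLinearMap.id ℝ ℝ) (Module.Basis.singleton Unit ℝ) (Window γ) ∧
      (∀ μ ν, WindowedDecay F ℰ (ContinuousLinearMap.id ℝ ℝ) (Module.Basis.singleton Unit ℝ) (Window γ) μ ν κ) ∧
      WindowedNE9 F ℰ (ContinuousLinearMap.id ℝ ℝ) (Module.Basis.singleton Unit ℝ) (Window γ) κ (crossLetters γ ω κ diag01).moduli ∧
      (∀ s, WindowedStepRate F ℰ (ContinuousLinearMap.id ℝ ℝ) (Module.Basis.singleton Unit ℝ) γ s κ ω ((|γ| * ω * wt κ diag01) * ω)) ∧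
      KernelStepRate F ℰ (ContinuousLinearMap.id ℝ ℝ) (Module.Basis.singleton Unit ℝ) γ κ ω (|γ| * ω * wt κ diag01) ∧
      NE9 (EA F ℰ (ContinuousLinearMap.id ℝ ℝ) (Module.Basis.singleton Unit ℝ)) (Window γ) κ (crossLetters γ ω κ diag01).moduli ∧
      (∀ μ ν, KernelDecay F ℰ (ContinuousLinearMap.id ℝ ℝ) (Module.Basis.singleton Unit ℝ) (Window γ) μ ν κ) ∧
      ¬ BoxwiseConstant γ (betaMerged F ℰ (ContinuousLinearMap.id ℝ ℝ) (Module.Basis.singleton Unit ℝ)) ∧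
      (∀ b : ℕ → ℝ, RemainderNonvanishingOnBoxes γ (betaMerged F ℰ (ContinuousLinearMap.id ℝ ℝ) (Module.Basis.singleton Unit ℝ)) b) ∧
      (∀ v₀, Beta0LimitExists (betaMerged F ℰ (ContinuousLinearMap.id ℝ ℝ) (Module.Basis.singleton Unit ℝ)) v₀) := by
  refine ⟨crossTermFamily F (fadingLaw ω) diag01, geometricIncrements_cross F _ _ γ 0, polLimitsExist_cross F _ _ γ,
    fun μ ν => windowedDecay_fadingCross F hω.le hω1 γ diag01 μ ν κ, windowedNE9_fadingCross F hω.le γ diag01 κ,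
    fun s => windowedStepRate_fadingCross F hω.le γ diag01 s κ, kernelStepRate_fadingCross F hω.le γ diag01 κ, ne9_EA_fadingCross F hω.le γ diag01 κ,
    fun μ ν => kernelDecay_fadingCross F hω.le hω1 γ diag01 μ ν κ, ?_, ?_, ?_⟩
  · exact not_boxwiseConstant_betaMerged_cross F (not_boxwiseConstant_fadingLaw hω.ne' hγ)
  · exact fun b => remainderNonvanishingOnBoxes_cross F
      (YMDAG.N18.BetaBoxDegeneracy.remainderNonvanishingOnBoxes_of_not_boxwiseConstant (not_boxwiseConstant_fadingLaw hω.ne' hγ) b)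
  · exact fun v₀ => beta0LimitExists_cross F (beta0LimitExists_fadingLaw ω v₀)

end Fading

end YMDAG.N18.RunningBetaLettersModel

end
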